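import Summits.ResolutionOfSingularities.ResolutionOfSingularities.Theorems.FrobeniusLadderFRationalResolutionKernelLattice
import Mathlib.LinearAlgebra.Dimension.Constructions
import Mathlib.Algebra.Order.Pi
import HarnessLib

/-!
# Crux `FrobeniusLadder.FRationalResolution` (stmt-ResolutionOfSingularities-15317), line `redirect`,
# stub `stub_diagonalizableQuotientResolution` — the FACE of the fixed-point chart at a nearby prime
# has rank `|J|` (the rank term of Kato's (2.1)(ii) on the invariant neighbourhood; memo §6–§7, step (f))

For the monomial chart `P = {m ∈ ℕⁿ : Σ mᵢ aᵢ = 0}` (`aᵢ` of finite order) at a prime where exactly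
the `x_j`, `j ∈ J`, are units, the face is `{m ∈ P : supp m ⊆ J}`; its `ℤ`-span in `ℤⁿ` has rank
`|J|`, so Kato's rank term `n − rk` is `|I|`, `I = Jᶜ`, matching `dim S_𝔔' − dim S_𝔔'/(x_I)`
(`…RsopStrataNhd`). Proof as in `…KernelLattice`: the span sits between `N·ℤ^J` and `ℤ^J`
(`N = ∏ ord aᵢ`), both of rank `|J|`.

* **`finrank_span_face_eq_card`**:
  `finrank ℤ (span ℤ {v ≥ 0 | Σ vᵢ aᵢ = 0, v = 0 off J}) = |J|`.

Honest label: elementary brick (no stub closed). No definitions, no named facts, no sorry.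
[folklore; cite: Kato1994, Def. (2.1)]
-/

noncomputable section

-- single-problem summit: the doubled namespace component is forced
set_option linter.dupNamespace false

namespace Summit.ResolutionOfSingularities.ResolutionOfSingularities.Theorems.FRationalResolution.FaceRank

universe w

variable {A' : Type w} [AddCommGroup A'] {n : ℕ} (a : Fin n → A')

/-- **The face lattice has rank `|J|`.** For `a : Fin n → A'` with every `aᵢ` of finite order and
`J ⊆ Fin n`, the `ℤ`-span of `{v ∈ ℤⁿ : v ≥ 0, Σ vᵢ aᵢ = 0, vᵢ = 0 for i ∉ J}` has rank `|J|`.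
[folklore; cite: Kato1994, Def. (2.1)] -/
theorem finrank_span_face_eq_card (ha : ∀ i, IsOfFinAddOrder (a i)) (J : Finset (Fin n)) :
    Module.finrank ℤ (Submodule.span ℤ {v : Fin n → ℤ | 0 ≤ v ∧
      Fintype.linearCombination ℤ a v = 0 ∧ ∀ i ∉ J, v i = 0}) = J.card := by
  classical
  set F : Set (Fin n → ℤ) := {v : Fin n → ℤ | 0 ≤ v ∧
      Fintype.linearCombination ℤ a v = 0 ∧ ∀ i ∉ J, v i = 0} with hF
  -- the coordinate sublattice `ℤ^J ⊆ ℤⁿ` as the range of the extension-by-zero map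
  let E : (J → ℤ) →ₗ[ℤ] (Fin n → ℤ) :=
    Fintype.linearCombination ℤ (fun j : J => (Pi.single (j : Fin n) (1 : ℤ) : Fin n → ℤ))
  have hEapply : ∀ (c : J → ℤ) (i : Fin n), E c i = if h : i ∈ J then c ⟨i, h⟩ else 0 := by
    intro c i
    simp only [E, Fintype.linearCombination_apply, Finset.sum_apply, Pi.smul_apply, smul_eq_mul,
      Pi.single_apply]
    by_cases h : i ∈ J
    · rw [dif_pos h, Finset.sum_eq_single (⟨i, h⟩ : J)]
      · simp
      · intro j _ hj
        have : (i : Fin n) ≠ (j : Fin n) := fun h' => hj (Subtype.ext h'.symm)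
        simp [this]
      · intro hj; exact absurd (Finset.mem_univ _) hj
    · rw [dif_neg h]
      refine Finset.sum_eq_zero fun j _ => ?_
      have : (i : Fin n) ≠ (j : Fin n) := fun h' => h (h' ▸ j.2)
      simp [this]
  have hEinj : Function.Injective E := by
    intro c c' h
    funext j
    have h1 := congrFun h (j : Fin n)
    rw [hEapply, hEapply, dif_pos j.2, dif_pos j.2] at h1
    exact h1
  have hrankE : Module.finrank ℤ (LinearMap.range E) = J.card := by
    rw [LinearMap.finrank_range_of_inj hEinj, Module.finrank_fintype_fun_eq_card, Fintype.card_coe]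
  -- upper bound: `span F ≤ range E`
  have hupper : Submodule.span ℤ F ≤ LinearMap.range E := by
    refine Submodule.span_le.mpr fun v hv => ?_
    obtain ⟨-, -, hvJ⟩ := hv
    refine ⟨fun j => v j, ?_⟩
    funext i
    rw [hEapply]
    by_cases h : i ∈ J
    · rw [dif_pos h]
    · rw [dif_neg h, hvJ i h]
  -- lower bound: `N • range E ≤ span F`, `N = ∏ ord aᵢ`
  set N : ℤ := ((∏ i, addOrderOf (a i) : ℕ) : ℤ) with hNdef
  have hN0 : N ≠ 0 := by
    rw [hNdef, Int.natCast_ne_zero, Finset.prod_ne_zero_iff]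
    exact fun i _ => (ha i).addOrderOf_pos.ne'
  have hNa : ∀ i, N • a i = 0 := fun i => by
    rw [hNdef, natCast_zsmul]
    obtain ⟨c, hc⟩ := Finset.dvd_prod_of_mem (fun j => addOrderOf (a j)) (Finset.mem_univ i)
    rw [hc, mul_nsmul, addOrderOf_nsmul_eq_zero, smul_zero]
  have hsingle : ∀ j : J, N • (Pi.single (j : Fin n) (1 : ℤ) : Fin n → ℤ) ∈ F := by
    intro j
    refine ⟨?_, ?_, ?_⟩
    · intro i
      simp only [Pi.smul_apply, Pi.single_apply, smul_eq_mul, Pi.zero_apply]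
      split_ifs
      · rw [mul_one, hNdef]; exact_mod_cast Nat.zero_le _
      · rw [mul_zero]
    · rw [map_zsmul, Fintype.linearCombination_apply, Finset.sum_eq_single (j : Fin n)]
      · simp [hNa]
      · intro i _ hi; simp [hi]
      · intro h; exact absurd (Finset.mem_univ _) h
    · intro i hi
      have : (i : Fin n) ≠ (j : Fin n) := fun h' => hi (h' ▸ j.2)
      simp [this]
  have hlower : LinearMap.range (N • E) ≤ Submodule.span ℤ F := by
    rintro _ ⟨c, rfl⟩
    rw [LinearMap.smul_apply, Fintype.linearCombination_apply (R := ℤ), Finset.smul_sum]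
    refine Submodule.sum_mem _ fun j _ => ?_
    rw [smul_comm]
    exact Submodule.smul_mem _ _ (Submodule.subset_span (hsingle j))
  have hNEinj : Function.Injective (N • E) := fun c c' h => by
    apply hEinj
    have h' : N • E c = N • E c' := by simpa using h
    exact smul_right_injective (Fin n → ℤ) hN0 h'
  apply le_antisymm
  · calc Module.finrank ℤ (Submodule.span ℤ F) ≤ Module.finrank ℤ (LinearMap.range E) :=
          Submodule.finrank_mono hupper
      _ = J.card := hrankE
  · calc J.card = Module.finrank ℤ (J → ℤ) := by
          rw [Module.finrank_fintype_fun_eq_card, Fintype.card_coe]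
      _ = Module.finrank ℤ (LinearMap.range (N • E)) := (LinearMap.finrank_range_of_inj hNEinj).symm
      _ ≤ Module.finrank ℤ (Submodule.span ℤ F) := Submodule.finrank_mono hlower

end Summit.ResolutionOfSingularities.ResolutionOfSingularities.Theorems.FRationalResolution.FaceRank

end
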